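import Summits.Ventures.YMGap.RobustBall.LimitStateClustering
import Summits.Ventures.YMGap.RobustBall.UniformPlaquetteSusceptibility
import Summits.Ventures.YMGap.Thresholds.StateLipschitzRows
import Summits.Ventures.YMGap.Thresholds.RegionBoundaryTiltLipschitz
import Summits.Ventures.YMGap.Thresholds.TorusStateResponse
import HarnessLib

/-!
# Venture YMGap, track ROBUST-BALL (Y2) — THE EXTENSIVE ENERGY-VARIANCE CEILING ON THE TIER-1 TORUS BALL, uniformly in the volume,
# from the torus clustering currency `ClustersWith` / `TorusClusteringOnBall`

HONEST FRAMING. WHAT THIS IS: a venture file (cell `pub-ymgap`, track Y2 ROBUST-BALL, seat rb-p2, theorems only, 0 compute).  Finite-volume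
(torus) LATTICE statements for `SU(N)` lattice Yang–Mills perturbed by a member `W` of rb-theory's torus ball, INSIDE the robust Dobrushin
door, i.e. under ds-2's clustering currency `ClustersWith W β A m` (`RobustBall/Defs.lean`; hypothesis-free rows for `SU(2)`, `d = 4` are
`TorusRowsSU2*`): the companion CEILING of this seat's door-free FLOOR `FreeEnergyStrongConvexityBall.ball_floor_le_variance_wilsonAction`.
* `sum_exp_neg_mul_torusNorm_le` — the TORUS lattice sum `Σ_{y ∈ (ℤ/L)^d} e^{−m‖y − x‖_T} ≤ ((1+r)/(1−r))^d`, `r = e^{−m/d}`, uniformly in `L`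
  (centred lift to `ℤ^d`, ds-1's `exists_centredLift`, and rb-p1's `ℓ¹` geometric sum `sum_pow_l1_sub_le`).
* `abs_cov_plaquette_le_of_clustersWith` — ONE PAIR: `ClustersWith W β A m` (`A ≥ 0`, `m ≥ 0`) ⇒ for all torus plaquettes `p, q`:
  `|Cov_{μ_{Λ,β,W}}(Re tr U_p, Re tr U_q)| ≤ 16 N A e^{2m} e^{−m‖p − q‖_T}` (the plaquette observables are transported Lipschitz cylinders:
  `isCylinder_plaquetteObs`, `StateLipschitzRows.isLipBound_plaquetteObs`, `LimitStateClustering.isLipBound_toTorusObservable`).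
* `sum_abs_cov_plaquette_le_of_clustersWith` — TORUS SUSCEPTIBILITY: `Σ_q |Cov(Re tr U_p, Re tr U_q)| ≤ χ_T`,
  `χ_T = 16 N A e^{2m} · #orient · ((1+r)/(1−r))^d`, uniformly in `L` and in the member.
* ★★ `variance_wilsonAction_le_of_clustersWith` — EXTENSIVE CEILING: `Var_{μ_{Λ_L,β,W}}(S_W) ≤ χ_T · #orient · L^d`; with the currency
  `TorusClusteringOnBall N d β ε₀ ε₁ r A m` this holds for EVERY member of `ClusterDomainFR ε₀ ε₁ r` on every torus `L ≥ 3`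
  (`variance_wilsonAction_le_onBall`).
WHAT THIS IS NOT: valid only inside the door (the clustering currency is the hypothesis); constants are Dobrushin artefacts; nothing about
the continuum limit or a Clay-sense mass gap.

References: R. L. Dobrushin, S. B. Shlosman (1985); B. Simon, *The Statistical Mechanics of Lattice Gases* I (1993), §II.12; the tree's
`Defs.lean` (`ClustersWith`), `LimitStateClustering.lean` (transport), `LatticeSumL1.lean`.  Everything here is proved. [folklore]
-/

noncomputable section

open MeasureTheory ProbabilityTheory Finset Function Filter Topology
open Literature.Probability.LatticeModels (Torus.proj Torus.proj_apply)
open Literature.MathematicalPhysics.QuantumLattice hiding torusNorm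
open Literature.MathematicalPhysics.QuantumFieldTheory hiding ZdEdge Site
open Summit.Ventures.YMGap.CouplingResponse (exists_centredLift plaquetteObs_torusLift)

namespace Summit.Ventures.YMGap.RobustBall

namespace EnergyVariance

variable {d L N : ℕ} [NeZero L]

/-! ### Part A — the torus lattice sum -/

/-- The canonical integer lift of a torus site projects back to it. [folklore] -/
theorem proj_valLift (x : Literature.MathematicalPhysics.QuantumFieldTheory.Site d L) :
    Torus.proj L (fun i => ((x i).val : ℤ)) = x := by
  funext i
  simp [Torus.proj_apply]

/-- **Torus lattice sum, uniform in the volume**: for `m > 0`, `d ≥ 1` and every site `x` of `(ℤ/L)^d`,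
`Σ_y e^{−m‖y − x‖_T} ≤ ((1 + e^{−m/d})/(1 − e^{−m/d}))^d`. [folklore] -/
theorem sum_exp_neg_mul_torusNorm_le (hd : 1 ≤ d) {m : ℝ} (hm : 0 < m)
    (x : Literature.MathematicalPhysics.QuantumFieldTheory.Site d L) :
    ∑ y : Literature.MathematicalPhysics.QuantumFieldTheory.Site d L, Real.exp (-m * (torusNorm (y - x) : ℝ)) ≤
      ((1 + Real.exp (-(m / d))) / (1 - Real.exp (-(m / d)))) ^ d := by
  classical
  set x₀ : Literature.Probability.LatticeModels.Site d := fun i => ((x i).val : ℤ) with hx₀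
  have hx : Torus.proj L x₀ = x := proj_valLift x
  obtain ⟨s, hs, hcen, -⟩ := exists_centredLift L x₀ (d := d)
  set r : ℝ := Real.exp (-(m / d)) with hr
  have hr0 : 0 ≤ r := (Real.exp_pos _).le
  have hd0 : (0 : ℝ) < d := by exact_mod_cast hd
  have hr1 : r < 1 := Real.exp_lt_one_iff.2 (by rw [neg_lt_zero]; exact div_pos hm hd0)
  have hsinj : Function.Injective s := fun y y' h => by rw [← hs y, ← hs y', h]
  calc ∑ y : Literature.MathematicalPhysics.QuantumFieldTheory.Site d L, Real.exp (-m * (torusNorm (y - x) : ℝ))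
      = ∑ y : Literature.MathematicalPhysics.QuantumFieldTheory.Site d L, Real.exp (-m * ‖s y - x₀‖) := by
        refine Finset.sum_congr rfl fun y _ => ?_
        rw [← hx, hcen y, Literature.Probability.LatticeModels.Site.norm_eq_supNorm]
    _ ≤ ∑ y : Literature.MathematicalPhysics.QuantumFieldTheory.Site d L, r ^ l1 (s y - x₀) :=
        Finset.sum_le_sum fun y _ => exp_neg_norm_le_pow hd hm.le (s y - x₀)
    _ = ∑ z ∈ (Finset.univ : Finset (Literature.MathematicalPhysics.QuantumFieldTheory.Site d L)).image s, r ^ l1 (z - x₀) := by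
        rw [Finset.sum_image fun y _ y' _ h => hsinj h]
    _ = ∑ z ∈ (Finset.univ : Finset (Literature.MathematicalPhysics.QuantumFieldTheory.Site d L)).image s, r ^ l1 (x₀ - z) := by
        refine Finset.sum_congr rfl fun z _ => ?_
        rw [l1_sub_comm]
    _ ≤ ((1 + r) / (1 - r)) ^ d := sum_pow_l1_sub_le hr0 hr1 x₀ _

/-! ### Part B — the torus plaquette observables are transported Lipschitz cylinders -/

/-- The torus plaquette observable `Re tr ρ(U_q)` is the torus restriction of the `ℤ^d` plaquette observable at the integer lift of its
base point. [folklore] -/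
theorem plaquetteObs_eq_toTorusObservable {G : Type*} [Group G] (ρ : G →* Matrix (Fin N) (Fin N) ℂ) (q : Plaquette d L) :
    (fun U : GaugeConfig d L G => (ρ (plaquetteHolonomy U q.1 q.2.1.1 q.2.1.2)).trace.re) =
      toTorusObservable L (plaquetteObs ρ (fun i => ((q.1 i).val : ℤ)) q.2.1.1 q.2.1.2) := by
  funext U
  rw [toTorusObservable_apply, plaquetteObs_torusLift, proj_valLift]

omit [NeZero L] in
/-- Base points of links of two plaquettes of `ℤ^d` project to torus sites at periodic distance `≥ ‖p̄ − q̄‖_T − 2`. [folklore] -/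
theorem torusNorm_sub_le_torusNorm_torusEdge_add_two {p q : ZdPlaquette d} {e f : Literature.MathematicalPhysics.QuantumFieldTheory.ZdEdge d}
    (he : e ∈ plaquetteEdges p) (hf : f ∈ plaquetteEdges q) :
    torusNorm ((Torus.proj L p.1 : Literature.MathematicalPhysics.QuantumFieldTheory.Site d L) - Torus.proj L q.1) ≤
      torusNorm ((torusEdge L e).1 - (torusEdge L f).1) + 2 := by
  -- each link base is within torus distance `1` of its plaquette base
  have hnear : ∀ {p' : ZdPlaquette d} {e' : Literature.MathematicalPhysics.QuantumFieldTheory.ZdEdge d}, e' ∈ plaquetteEdges p' →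
      torusNorm ((Torus.proj L p'.1 : Literature.MathematicalPhysics.QuantumFieldTheory.Site d L) - (torusEdge L e').1) ≤ 1 := by
    intro p' e' he'
    have h0 : (p'.1, p'.2.1.1) ∈ plaquetteEdges p' := by simp [plaquetteEdges]
    have h1 := norm_sub_le_one_of_mem_plaquetteEdges h0 he'
    rw [Literature.Probability.LatticeModels.Site.norm_eq_supNorm] at h1
    have h2 : Literature.Probability.LatticeModels.Site.supNorm (p'.1 - e'.1) ≤ 1 := by exact_mod_cast h1
    have h3 : (Torus.proj L p'.1 : Literature.MathematicalPhysics.QuantumFieldTheory.Site d L) - (torusEdge L e').1 =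
        Torus.proj L (p'.1 - e'.1) := by
      funext i; simp [torusEdge, Torus.proj, Int.cast_sub]
    rw [h3]
    exact (torusNorm_proj_le _).trans h2
  have hp := hnear he
  have hq := hnear hf
  have hq' : torusNorm ((torusEdge L f).1 - (Torus.proj L q.1 : Literature.MathematicalPhysics.QuantumFieldTheory.Site d L)) ≤ 1 := by
    rw [← torusNorm_neg, neg_sub]; exact hq
  have t1 := torusNorm_sub_le (Torus.proj L p.1 : Literature.MathematicalPhysics.QuantumFieldTheory.Site d L) (torusEdge L e).1
    (Torus.proj L q.1)
  have t2 := torusNorm_sub_le (torusEdge L e).1 (torusEdge L f).1 (Torus.proj L q.1 : Literature.MathematicalPhysics.QuantumFieldTheory.Site d L)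
  omega

/-- **ONE PAIR, `ℤ^d`-indexed.**  `ClustersWith W β A m` (`A ≥ 0`, `m ≥ 0`) bounds the covariance of the torus restrictions of two `ℤ^d`
plaquette observables: `|Cov_{μ_{Λ,β,W}}(Re tr U_{p̄}, Re tr U_{q̄})| ≤ 16 N A e^{2m} e^{−m‖p̄ − q̄‖_T}`. [folklore] -/
theorem abs_cov_toTorusObservable_plaquetteObs_le {W : Perturbation d L N} {β A m : ℝ} (hW : ClustersWith W β A m) (hA : 0 ≤ A)
    (hm : 0 ≤ m) (pz qz : ZdPlaquette d) :
    |cov[toTorusObservable L (plaquetteObs (fundamentalRep (Fin N)) pz.1 pz.2.1.1 pz.2.1.2),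
        toTorusObservable L (plaquetteObs (fundamentalRep (Fin N)) qz.1 qz.2.1.1 qz.2.1.2);
        W.perturbedMeasure (fundamentalRep (Fin N)) β]| ≤
      16 * N * A * Real.exp (2 * m) *
        Real.exp (-m * (torusNorm ((Torus.proj L pz.1 : Literature.MathematicalPhysics.QuantumFieldTheory.Site d L) - Torus.proj L qz.1) : ℝ)) := by
  classical
  haveI : SecondCountableTopology (Matrix (Fin N) (Fin N) ℂ) :=
    inferInstanceAs (SecondCountableTopology (Fin N → Fin N → ℂ))
  haveI : SecondCountableTopology (SUN N) := Topology.IsEmbedding.subtypeVal.secondCountableTopology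
  have hρc : Continuous (fundamentalRep (Fin N) : SUN N →* Matrix (Fin N) (Fin N) ℂ) := continuous_fundamentalRep (Fin N)
  have hD : torusNorm ((Torus.proj L pz.1 : Literature.MathematicalPhysics.QuantumFieldTheory.Site d L) - Torus.proj L qz.1) - 2 ≤
      torusNorm ((Torus.proj L pz.1 : Literature.MathematicalPhysics.QuantumFieldTheory.Site d L) - Torus.proj L qz.1) := Nat.sub_le _ _
  -- the clustering currency applied to the two transported cylinders
  have key := hW (toTorusObservable L (plaquetteObs (fundamentalRep (Fin N)) pz.1 pz.2.1.1 pz.2.1.2))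
    (toTorusObservable L (plaquetteObs (fundamentalRep (Fin N)) qz.1 qz.2.1.1 qz.2.1.2))
    ((plaquetteEdges pz).image (torusEdge L)) ((plaquetteEdges qz).image (torusEdge L))
    (fun eb => ∑ x ∈ (plaquetteEdges pz).filter (fun x => torusEdge L x = eb), (if x ∈ plaquetteEdges pz then Real.sqrt N else 0))
    (fun eb => ∑ x ∈ (plaquetteEdges qz).filter (fun x => torusEdge L x = eb), (if x ∈ plaquetteEdges qz then Real.sqrt N else 0))
    (torusNorm ((Torus.proj L pz.1 : Literature.MathematicalPhysics.QuantumFieldTheory.Site d L) - Torus.proj L qz.1) - 2)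
    ((measurable_plaquetteObs (fundamentalRep (Fin N)) hρc pz.1 pz.2.1.1 pz.2.1.2).comp (measurable_torusLift L))
    ((measurable_plaquetteObs (fundamentalRep (Fin N)) hρc qz.1 qz.2.1.1 qz.2.1.2).comp (measurable_torusLift L))
    (dependsOn_toTorusObservable L (isCylinder_plaquetteObs (fundamentalRep (Fin N)) pz))
    (dependsOn_toTorusObservable L (isCylinder_plaquetteObs (fundamentalRep (Fin N)) qz))
    ⟨N, fun U => LatticeBakryEmery.abs_plaquetteObs_le_N pz (torusLift L U)⟩
    ⟨N, fun U => LatticeBakryEmery.abs_plaquetteObs_le_N qz (torusLift L U)⟩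
    (isLipBound_toTorusObservable L suFrobDist_self (isCylinder_plaquetteObs (fundamentalRep (Fin N)) pz)
      (StateLipschitzRows.isLipBound_plaquetteObs pz))
    (isLipBound_toTorusObservable L suFrobDist_self (isCylinder_plaquetteObs (fundamentalRep (Fin N)) qz)
      (StateLipschitzRows.isLipBound_plaquetteObs qz))
    (fun eb heb fb hfb => by
      obtain ⟨e, he, rfl⟩ := Finset.mem_image.1 heb
      obtain ⟨f, hf, rfl⟩ := Finset.mem_image.1 hfb
      have h := torusNorm_sub_le_torusNorm_torusEdge_add_two (L := L) he hf
      omega)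
  rw [sum_image_fibre_eq, sum_image_fibre_eq] at key
  -- the Lipschitz sums are `≤ 4√N` each
  have hsum : ∀ (p' : ZdPlaquette d), ∑ x ∈ plaquetteEdges p', (if x ∈ plaquetteEdges p' then Real.sqrt N else 0) ≤ 4 * Real.sqrt N := by
    intro p'
    rw [Finset.sum_ite_of_true (fun x hx => hx), Finset.sum_const, nsmul_eq_mul]
    exact mul_le_mul_of_nonneg_right (by exact_mod_cast card_plaquetteEdges_le p') (Real.sqrt_nonneg _)
  have hsum0 : ∀ (p' : ZdPlaquette d), 0 ≤ ∑ x ∈ plaquetteEdges p', (if x ∈ plaquetteEdges p' then Real.sqrt N else 0) :=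
    fun p' => Finset.sum_nonneg fun x _ => by positivity
  -- the exponent: `n ≥ ‖p − q‖_T − 2`
  have hexp : Real.exp (-m * ((torusNorm ((Torus.proj L pz.1 : Literature.MathematicalPhysics.QuantumFieldTheory.Site d L) -
      Torus.proj L qz.1) - 2 : ℕ) : ℝ)) ≤ Real.exp (2 * m) *
        Real.exp (-m * (torusNorm ((Torus.proj L pz.1 : Literature.MathematicalPhysics.QuantumFieldTheory.Site d L) - Torus.proj L qz.1) : ℝ)) := by
    rw [← Real.exp_add]
    refine Real.exp_le_exp.2 ?_
    have h2 : ((torusNorm ((Torus.proj L pz.1 : Literature.MathematicalPhysics.QuantumFieldTheory.Site d L) - Torus.proj L qz.1) : ℕ) : ℝ) ≤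
        ((torusNorm ((Torus.proj L pz.1 : Literature.MathematicalPhysics.QuantumFieldTheory.Site d L) - Torus.proj L qz.1) - 2 : ℕ) : ℝ) + 2 := by
      have : torusNorm ((Torus.proj L pz.1 : Literature.MathematicalPhysics.QuantumFieldTheory.Site d L) - Torus.proj L qz.1) ≤
          torusNorm ((Torus.proj L pz.1 : Literature.MathematicalPhysics.QuantumFieldTheory.Site d L) - Torus.proj L qz.1) - 2 + 2 := by omega
      exact_mod_cast this
    nlinarith
  refine key.trans ?_
  have hA' : 0 ≤ A * (4 * Real.sqrt N) := by positivity
  calc A * (∑ x ∈ plaquetteEdges qz, (if x ∈ plaquetteEdges qz then Real.sqrt N else 0)) *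
        (∑ x ∈ plaquetteEdges pz, (if x ∈ plaquetteEdges pz then Real.sqrt N else 0)) *
        Real.exp (-m * ((torusNorm ((Torus.proj L pz.1 : Literature.MathematicalPhysics.QuantumFieldTheory.Site d L) -
          Torus.proj L qz.1) - 2 : ℕ) : ℝ))
      ≤ A * (4 * Real.sqrt N) * (4 * Real.sqrt N) * (Real.exp (2 * m) *
          Real.exp (-m * (torusNorm ((Torus.proj L pz.1 : Literature.MathematicalPhysics.QuantumFieldTheory.Site d L) - Torus.proj L qz.1) : ℝ))) := by
        refine mul_le_mul ?_ hexp (Real.exp_pos _).le (by positivity)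
        exact mul_le_mul (mul_le_mul_of_nonneg_left (hsum qz) hA) (hsum pz) (hsum0 pz) hA'
    _ = 16 * N * A * Real.exp (2 * m) *
          Real.exp (-m * (torusNorm ((Torus.proj L pz.1 : Literature.MathematicalPhysics.QuantumFieldTheory.Site d L) - Torus.proj L qz.1) : ℝ)) := by
        have hN : Real.sqrt N * Real.sqrt N = N := Real.mul_self_sqrt (Nat.cast_nonneg N)
        linear_combination (16 * A * Real.exp (2 * m) *
          Real.exp (-m * (torusNorm ((Torus.proj L pz.1 : Literature.MathematicalPhysics.QuantumFieldTheory.Site d L) -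
            Torus.proj L qz.1) : ℝ))) * hN

/-- ★ **ONE PAIR.**  `ClustersWith W β A m` (`A ≥ 0`, `m ≥ 0`) bounds the covariance of any two torus plaquette observables under the
member's torus state: `|Cov_{μ_{Λ,β,W}}(Re tr U_p, Re tr U_q)| ≤ 16 N A e^{2m} e^{−m‖p − q‖_T}`. [folklore] -/
theorem abs_cov_plaquette_le_of_clustersWith {W : Perturbation d L N} {β A m : ℝ} (hW : ClustersWith W β A m) (hA : 0 ≤ A)
    (hm : 0 ≤ m) (p q : Plaquette d L) :
    |cov[fun U : GaugeConfig d L (SUN N) => ((fundamentalRep (Fin N)) (plaquetteHolonomy U p.1 p.2.1.1 p.2.1.2)).trace.re,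
        fun U : GaugeConfig d L (SUN N) => ((fundamentalRep (Fin N)) (plaquetteHolonomy U q.1 q.2.1.1 q.2.1.2)).trace.re;
        W.perturbedMeasure (fundamentalRep (Fin N)) β]| ≤
      16 * N * A * Real.exp (2 * m) * Real.exp (-m * (torusNorm (p.1 - q.1) : ℝ)) := by
  have h := abs_cov_toTorusObservable_plaquetteObs_le hW hA hm ((fun i => ((p.1 i).val : ℤ)), p.2) ((fun i => ((q.1 i).val : ℤ)), q.2)
  rw [plaquetteObs_eq_toTorusObservable (fundamentalRep (Fin N)) p, plaquetteObs_eq_toTorusObservable (fundamentalRep (Fin N)) q]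
  simpa only [proj_valLift] using h

/-- ★ **TORUS PLAQUETTE SUSCEPTIBILITY, uniform in the volume and on the ball.**  `ClustersWith W β A m` (`A ≥ 0`, `m > 0`, `d ≥ 1`) ⇒ for
every torus plaquette `p`: `Σ_q |Cov_{μ_{Λ,β,W}}(Re tr U_p, Re tr U_q)| ≤ 16 N A e^{2m} · #orient · ((1+r)/(1−r))^d`, `r = e^{−m/d}`. [folklore] -/
theorem sum_abs_cov_plaquette_le_of_clustersWith (hd : 1 ≤ d) {W : Perturbation d L N} {β A m : ℝ} (hW : ClustersWith W β A m)
    (hA : 0 ≤ A) (hm : 0 < m) (p : Plaquette d L) :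
    ∑ q : Plaquette d L,
        |cov[fun U : GaugeConfig d L (SUN N) => ((fundamentalRep (Fin N)) (plaquetteHolonomy U p.1 p.2.1.1 p.2.1.2)).trace.re,
          fun U : GaugeConfig d L (SUN N) => ((fundamentalRep (Fin N)) (plaquetteHolonomy U q.1 q.2.1.1 q.2.1.2)).trace.re;
          W.perturbedMeasure (fundamentalRep (Fin N)) β]| ≤
      16 * N * A * Real.exp (2 * m) * (Fintype.card {ij : Fin d × Fin d // ij.1 < ij.2} : ℝ) *
        ((1 + Real.exp (-(m / d))) / (1 - Real.exp (-(m / d)))) ^ d := by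
  classical
  set K : ℝ := 16 * N * A * Real.exp (2 * m) with hK
  have hK0 : 0 ≤ K := by positivity
  calc ∑ q : Plaquette d L,
        |cov[fun U : GaugeConfig d L (SUN N) => ((fundamentalRep (Fin N)) (plaquetteHolonomy U p.1 p.2.1.1 p.2.1.2)).trace.re,
          fun U : GaugeConfig d L (SUN N) => ((fundamentalRep (Fin N)) (plaquetteHolonomy U q.1 q.2.1.1 q.2.1.2)).trace.re;
          W.perturbedMeasure (fundamentalRep (Fin N)) β]|
      ≤ ∑ q : Plaquette d L, K * Real.exp (-m * (torusNorm (p.1 - q.1) : ℝ)) :=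
        Finset.sum_le_sum fun q _ => abs_cov_plaquette_le_of_clustersWith hW hA hm.le p q
    _ = ∑ y : Literature.MathematicalPhysics.QuantumFieldTheory.Site d L, ∑ _o : {ij : Fin d × Fin d // ij.1 < ij.2},
          K * Real.exp (-m * (torusNorm (y - p.1) : ℝ)) := by
        rw [← Finset.univ_product_univ, Finset.sum_product]
        refine Finset.sum_congr rfl fun y _ => Finset.sum_congr rfl fun o _ => ?_
        rw [← torusNorm_neg, neg_sub]
    _ = K * (Fintype.card {ij : Fin d × Fin d // ij.1 < ij.2} : ℝ) *
          ∑ y : Literature.MathematicalPhysics.QuantumFieldTheory.Site d L, Real.exp (-m * (torusNorm (y - p.1) : ℝ)) := by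
        rw [Finset.mul_sum]
        refine Finset.sum_congr rfl fun y _ => ?_
        rw [Finset.sum_const, Finset.card_univ, nsmul_eq_mul]
        ring
    _ ≤ K * (Fintype.card {ij : Fin d × Fin d // ij.1 < ij.2} : ℝ) * ((1 + Real.exp (-(m / d))) / (1 - Real.exp (-(m / d)))) ^ d :=
        mul_le_mul_of_nonneg_left (sum_exp_neg_mul_torusNorm_le hd hm p.1) (by positivity)

/-- ★★ **EXTENSIVE CEILING FOR THE ENERGY VARIANCE OF A MEMBER'S TORUS STATE.**  `ClustersWith W β A m` (`A ≥ 0`, `m > 0`, `d ≥ 1`) ⇒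
`Var_{μ_{Λ_L,β,W}}(S_W) ≤ (16 N A e^{2m} · #orient · ((1+r)/(1−r))^d) · #orient · L^d` — linear in the volume, with a slope uniform in
`L` and in the member. [folklore] -/
theorem variance_wilsonAction_le_of_clustersWith (hd : 1 ≤ d) {W : Perturbation d L N} {β A m : ℝ} (hW : ClustersWith W β A m)
    (hA : 0 ≤ A) (hm : 0 < m) :
    Var[wilsonAction (d := d) (L := L) (G := SUN N) (fundamentalRep (Fin N)); W.perturbedMeasure (fundamentalRep (Fin N)) β] ≤
      (16 * N * A * Real.exp (2 * m) * (Fintype.card {ij : Fin d × Fin d // ij.1 < ij.2} : ℝ) *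
          ((1 + Real.exp (-(m / d))) / (1 - Real.exp (-(m / d)))) ^ d) *
        (Fintype.card {ij : Fin d × Fin d // ij.1 < ij.2} : ℝ) * (L : ℝ) ^ d := by
  classical
  haveI : SecondCountableTopology (Matrix (Fin N) (Fin N) ℂ) :=
    inferInstanceAs (SecondCountableTopology (Fin N → Fin N → ℂ))
  haveI : SecondCountableTopology (SUN N) := Topology.IsEmbedding.subtypeVal.secondCountableTopology
  haveI : IsProbabilityMeasure (W.perturbedMeasure (fundamentalRep (Fin N)) β) := isProbabilityMeasure_perturbedMeasure W β
  set μ := W.perturbedMeasure (fundamentalRep (Fin N)) β with hμ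
  set P : Plaquette d L → GaugeConfig d L (SUN N) → ℝ := fun q U =>
    ((fundamentalRep (Fin N)) (plaquetteHolonomy U q.1 q.2.1.1 q.2.1.2)).trace.re with hP
  set χ : ℝ := 16 * N * A * Real.exp (2 * m) * (Fintype.card {ij : Fin d × Fin d // ij.1 < ij.2} : ℝ) *
    ((1 + Real.exp (-(m / d))) / (1 - Real.exp (-(m / d)))) ^ d with hχ
  have hρc : Continuous (fundamentalRep (Fin N) : SUN N →* Matrix (Fin N) (Fin N) ℂ) := continuous_fundamentalRep (Fin N)
  -- `S_W = N · #plaquettes − Σ_q P_q`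
  have hS : wilsonAction (d := d) (L := L) (G := SUN N) (fundamentalRep (Fin N)) =
      fun U => (N : ℝ) * (Fintype.card (Plaquette d L) : ℝ) - ∑ q : Plaquette d L, P q U := by
    funext U
    simp only [hP]
    unfold wilsonAction
    rw [Finset.sum_sub_distrib, Finset.sum_const, Finset.card_univ, nsmul_eq_mul]
    ring
  -- each `P q` is bounded measurable, hence in `L²`
  have hPm : ∀ q : Plaquette d L, Measurable (P q) := fun q => by
    simp only [hP]
    rw [plaquetteObs_eq_toTorusObservable (fundamentalRep (Fin N)) q]
    exact (measurable_plaquetteObs _ hρc _ _ _).comp (measurable_torusLift L)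
  have hPb : ∀ (q : Plaquette d L) (U : GaugeConfig d L (SUN N)), |P q U| ≤ N := fun q U => by
    have h := LatticeBakryEmery.abs_plaquetteObs_le_N ((fun i => ((q.1 i).val : ℤ), q.2) : ZdPlaquette d) (torusLift L U)
    have e := congrFun (plaquetteObs_eq_toTorusObservable (fundamentalRep (Fin N)) q) U
    simp only [toTorusObservable_apply] at e
    simp only [hP]
    rw [e]
    simpa using h
  have hL2 : ∀ q : Plaquette d L, MemLp (P q) 2 μ := fun q =>
    memLp_of_bounded (a := -(N : ℝ)) (b := N) (ae_of_all _ fun U => abs_le.1 (hPb q U)) (hPm q).aestronglyMeasurable 2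
  have hsumm : AEStronglyMeasurable (fun U => ∑ q : Plaquette d L, P q U) μ :=
    (Finset.measurable_sum _ fun q _ => hPm q).aestronglyMeasurable
  rw [hS, variance_const_sub hsumm, variance_fun_sum hL2]
  -- plaquette count
  have hcard : (Fintype.card (Plaquette d L) : ℝ) = (L : ℝ) ^ d * (Fintype.card {ij : Fin d × Fin d // ij.1 < ij.2} : ℝ) := by
    rw [Fintype.card_prod, Fintype.card_fun, ZMod.card, Fintype.card_fin]
    push_cast
    ring
  calc ∑ p : Plaquette d L, ∑ q : Plaquette d L, cov[P p, P q; μ]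
      ≤ ∑ p : Plaquette d L, ∑ q : Plaquette d L, |cov[P p, P q; μ]| :=
        Finset.sum_le_sum fun p _ => Finset.sum_le_sum fun q _ => le_abs_self _
    _ ≤ ∑ _p : Plaquette d L, χ := Finset.sum_le_sum fun p _ => sum_abs_cov_plaquette_le_of_clustersWith hd hW hA hm p
    _ = χ * (Fintype.card {ij : Fin d × Fin d // ij.1 < ij.2} : ℝ) * (L : ℝ) ^ d := by
        rw [Finset.sum_const, Finset.card_univ, nsmul_eq_mul, hcard]; ring

/-- ★★ **ON THE BALL**: the currency `TorusClusteringOnBall N d β ε₀ ε₁ r A m` (`A ≥ 0`, `m > 0`, `d ≥ 1`) gives the extensive ceiling for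
EVERY member `W ∈ ClusterDomainFR ε₀ ε₁ r` on every torus `L ≥ 3`, with one slope. [folklore] -/
theorem variance_wilsonAction_le_onBall (hd : 1 ≤ d) {β ε₀ ε₁ A m : ℝ} {r : ℕ} (h : TorusClusteringOnBall N d β ε₀ ε₁ r A m)
    (hA : 0 ≤ A) (hm : 0 < m) (hL : 3 ≤ L) {W : Perturbation d L N} (hW : W ∈ ClusterDomainFR ε₀ ε₁ r) :
    Var[wilsonAction (d := d) (L := L) (G := SUN N) (fundamentalRep (Fin N)); W.perturbedMeasure (fundamentalRep (Fin N)) β] ≤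
      (16 * N * A * Real.exp (2 * m) * (Fintype.card {ij : Fin d × Fin d // ij.1 < ij.2} : ℝ) *
          ((1 + Real.exp (-(m / d))) / (1 - Real.exp (-(m / d)))) ^ d) *
        (Fintype.card {ij : Fin d × Fin d // ij.1 < ij.2} : ℝ) * (L : ℝ) ^ d :=
  variance_wilsonAction_le_of_clustersWith hd (h L hL W hW) hA hm

end EnergyVariance

end Summit.Ventures.YMGap.RobustBall
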